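import Mathlib
import Literature.Geometry.Symplectic.SteinBall

/-!
# `HyperbolicEnd` (stmt-SmoothPoincare4-7825), line `Sketch`, negative side — Laplacian along a standard `J₀`-holomorphic curve

Helper for the native frozen refutation of the flat certificate-filling stub on `ℝ⁴ = ℂ²` with
`J` frozen to the constant standard complex structure
`J₀ = Literature.Geometry.Symplectic.stdComplexStructure` (`J₀(x₀, x₁, x₂, x₃) = (-x₁, x₀, -x₃, x₂)`).
Statement registered on the crux item (stub helper_frozen_laplacianComp).

**The statement.** Let `ψ : ℝ⁴ → ℝ` be of class `C²`, and let `g : ℂ → ℝ⁴` be smooth on the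
open set `U ∋ z` and `J₀`-holomorphic there (`Dg(w)(I ζ) = J₀ (Dg(w) ζ)` for `w ∈ U`).  Then,
with `a = Dg(z) 1`, `Δ(ψ ∘ g)(z) = D²ψ(g z)[a, a] + D²ψ(g z)[J₀ a, J₀ a]`: the Laplacian of `ψ`
along the curve is the `J₀`-trace of the Hessian of `ψ` on the complex line spanned by `a`.

**The computation.** `Δ(ψ ∘ g)(z) = D²(ψ ∘ g)(z)[1, 1] + D²(ψ ∘ g)(z)[I, I]`
(`InnerProductSpace.laplacian_eq_iteratedFDeriv_complexPlane`), and the second-order chain rule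
(`hessian_comp`) gives `D²(ψ ∘ g)(z)[v, v] = D²ψ(g z)[Dg(z) v, Dg(z) v] + Dψ(g z)(D²g(z)[v, v])`.
Here `Dg(z) I = J₀ a`, and `D²g(z)[I, I] = -D²g(z)[1, 1]` (`sndFDeriv_I_I`): differentiating
`Dg(w) I = J₀ (Dg(w) 1)` (valid near `z`; `J₀` is a constant linear map) gives
`D²g(z)[ζ, I] = J₀ D²g(z)[ζ, 1]` for all `ζ`, whence by the symmetry of second derivatives of
`C²` maps (`ContDiffAt.isSymmSndFDerivAt`) and `J₀² = -1`,
`D²g[I, I] = J₀ D²g[I, 1] = J₀ D²g[1, I] = J₀ J₀ D²g[1, 1] = -D²g[1, 1]`.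
So the first-order terms `Dψ(g z)(D²g(z)[v, v])` cancel in the sum over `v = 1, I`.
-/

noncomputable section

-- the prescribed namespace `Summit.<P>.<Sub>.…` duplicates `SmoothPoincare4` (P = Sub)
set_option linter.dupNamespace false

open scoped ContDiff Topology Real
open Laplacian Set Filter Metric Complex

namespace Summit.SmoothPoincare4.SmoothPoincare4.Theorems.HyperbolicEnd.Negative

open Literature.Geometry.Symplectic (stdComplexStructure stdComplexStructure_sq)

/-! ### Second derivatives: application to constant vectors, chain rule -/

/-- Applying the second derivative: `D²g(z)[ζ](ξ)` is the derivative in the direction `ζ` of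
`w ↦ Dg(w) ξ`. -/
private theorem fderiv_fderiv_apply {F : Type*} [NormedAddCommGroup F] [NormedSpace ℝ F]
    {g : ℂ → F} {z : ℂ} (hg : DifferentiableAt ℝ (fderiv ℝ g) z) (ζ ξ : ℂ) :
    fderiv ℝ (fderiv ℝ g) z ζ ξ = fderiv ℝ (fun w => fderiv ℝ g w ξ) z ζ := by
  rw [fderiv_clm_apply hg (differentiableAt_const ξ)]
  simp only [fderiv_fun_const, Pi.zero_apply, ContinuousLinearMap.comp_zero, zero_add,
    ContinuousLinearMap.flip_apply]

/-- **Second-order chain rule.** For `ψ` of class `C²` and `g` of class `C²` at `z`,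
`D²(ψ ∘ g)(z)[v, v] = D²ψ(g z)[Dg(z) v, Dg(z) v] + Dψ(g z)(D²g(z)[v, v])`. -/
private theorem hessian_comp {ψ : EuclideanSpace ℝ (Fin 4) → ℝ} {g : ℂ → EuclideanSpace ℝ (Fin 4)}
    {z : ℂ} (hψ : ContDiff ℝ 2 ψ) (hg : ContDiffAt ℝ 2 g z) (v : ℂ) :
    iteratedFDeriv ℝ 2 (fun w => ψ (g w)) z ![v, v] =
      iteratedFDeriv ℝ 2 ψ (g z) ![fderiv ℝ g z v, fderiv ℝ g z v] +
        fderiv ℝ ψ (g z) (fderiv ℝ (fderiv ℝ g) z v v) := by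
  -- differentiability of `ψ`, `Dψ`, `g`, `Dg`
  have hψd : ∀ x, DifferentiableAt ℝ ψ x := fun x => (hψ.differentiable two_ne_zero) x
  have hψ' : ∀ x, DifferentiableAt ℝ (fderiv ℝ ψ) x := fun x =>
    (hψ.contDiffAt.fderiv_right (m := 1) (by norm_num)).differentiableAt one_ne_zero
  have hgd : DifferentiableAt ℝ g z := hg.differentiableAt two_ne_zero
  have hg' : DifferentiableAt ℝ (fderiv ℝ g) z :=
    (hg.fderiv_right (m := 1) (by norm_num)).differentiableAt one_ne_zero
  -- near `z`, `D(ψ ∘ g)(w) = Dψ(g w) ∘ Dg(w)`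
  have hev : fderiv ℝ (fun w => ψ (g w)) =ᶠ[𝓝 z]
      fun w => (fderiv ℝ ψ (g w)).comp (fderiv ℝ g w) := by
    filter_upwards [hg.eventually (by simp)] with w hw
    exact fderiv_fun_comp w (hψd (g w)) (hw.differentiableAt two_ne_zero)
  -- the derivative of `w ↦ Dψ(g w)` at `z`
  have hc : HasFDerivAt (fun w => fderiv ℝ ψ (g w))
      ((fderiv ℝ (fderiv ℝ ψ) (g z)).comp (fderiv ℝ g z)) z :=
    (hψ' (g z)).hasFDerivAt.comp z hgd.hasFDerivAt
  rw [iteratedFDeriv_two_apply, iteratedFDeriv_two_apply]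
  simp only [Matrix.cons_val_zero, Matrix.cons_val_one, Matrix.cons_val_fin_one]
  rw [hev.fderiv_eq, fderiv_clm_comp hc.differentiableAt hg']
  simp only [add_apply, ContinuousLinearMap.comp_apply,
    ContinuousLinearMap.compL_apply, ContinuousLinearMap.flip_apply, hc.fderiv]
  ring

/-- **Mixed partials of a `J₀`-holomorphic curve.** If `g` is smooth on the open set `U ∋ z`
with `Dg(w)(I ζ) = J₀ (Dg(w) ζ)` there, then `D²g(z)[I, I] = -D²g(z)[1, 1]` (`g_yy = -g_xx`). -/
private theorem sndFDeriv_I_I {g : ℂ → EuclideanSpace ℝ (Fin 4)} {U : Set ℂ} {z : ℂ}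
    (hU : IsOpen U) (hz : z ∈ U) (hg : ContDiffOn ℝ ∞ g U)
    (hhol : ∀ z ∈ U, ∀ ζ : ℂ, fderiv ℝ g z (I * ζ) = stdComplexStructure (fderiv ℝ g z ζ)) :
    fderiv ℝ (fderiv ℝ g) z I I = -fderiv ℝ (fderiv ℝ g) z 1 1 := by
  have hg2 : ContDiffAt ℝ 2 g z :=
    ((hg z hz).contDiffAt (hU.mem_nhds hz)).of_le (WithTop.coe_le_coe.2 le_top)
  have hg' : DifferentiableAt ℝ (fderiv ℝ g) z :=
    (hg2.fderiv_right (m := 1) (by norm_num)).differentiableAt one_ne_zero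
  have hsymm : IsSymmSndFDerivAt ℝ g z := hg2.isSymmSndFDerivAt (by simp)
  -- near `z`, `Dg(w) I = J₀ (Dg(w) 1)`
  have hev : (fun w => fderiv ℝ g w I) =ᶠ[𝓝 z]
      fun w => stdComplexStructure (fderiv ℝ g w 1) := by
    filter_upwards [hU.mem_nhds hz] with w hw
    simpa using hhol w hw 1
  -- differentiate it at `z`: `D²g(z)[ζ, I] = J₀ D²g(z)[ζ, 1]`
  have h1 : DifferentiableAt ℝ (fun w => fderiv ℝ g w 1) z :=
    hg'.clm_apply (differentiableAt_const _)
  have hJ : HasFDerivAt (fun w => stdComplexStructure (fderiv ℝ g w 1))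
      (stdComplexStructure.comp (fderiv ℝ (fun w => fderiv ℝ g w 1) z)) z :=
    stdComplexStructure.hasFDerivAt.comp z h1.hasFDerivAt
  have key : ∀ ζ : ℂ,
      fderiv ℝ (fderiv ℝ g) z ζ I = stdComplexStructure (fderiv ℝ (fderiv ℝ g) z ζ 1) := by
    intro ζ
    rw [fderiv_fderiv_apply hg' ζ I, fderiv_fderiv_apply hg' ζ 1, hev.fderiv_eq, hJ.fderiv,
      ContinuousLinearMap.comp_apply]
  rw [key I, hsymm.eq I 1, key 1, stdComplexStructure_sq]

/-! ### The helper -/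

/-- helper (T4): **Laplacian along a standard `J₀`-holomorphic curve.** For `ψ : ℝ⁴ → ℝ` of
class `C²` and `g : ℂ → ℝ⁴` smooth and `J₀`-holomorphic on the open set `U ∋ z`
(`Dg(w)(I ζ) = J₀ (Dg(w) ζ)` on `U`), the Laplacian of `ψ ∘ g` at `z` is the `J₀`-trace of the
Hessian of `ψ` at `g z` on `a = Dg(z) 1`: `Δ(ψ ∘ g)(z) = D²ψ(g z)[a, a] + D²ψ(g z)[J₀ a, J₀ a]`. -/
theorem helper_frozen_laplacianComp : ∀ (ψ : EuclideanSpace ℝ (Fin 4) → ℝ) (U : Set ℂ)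
    (g : ℂ → EuclideanSpace ℝ (Fin 4)) (z : ℂ), IsOpen U → z ∈ U → ContDiff ℝ 2 ψ →
    ContDiffOn ℝ ∞ g U →
    (∀ z ∈ U, ∀ ζ : ℂ, fderiv ℝ g z (Complex.I * ζ) =
      Literature.Geometry.Symplectic.stdComplexStructure (fderiv ℝ g z ζ)) →
    (Δ (fun w => ψ (g w))) z =
      iteratedFDeriv ℝ 2 ψ (g z) ![fderiv ℝ g z 1, fderiv ℝ g z 1] +
        iteratedFDeriv ℝ 2 ψ (g z)
          ![Literature.Geometry.Symplectic.stdComplexStructure (fderiv ℝ g z 1),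
            Literature.Geometry.Symplectic.stdComplexStructure (fderiv ℝ g z 1)] := by
  intro ψ U g z hU hz hψ hg hhol
  have hg2 : ContDiffAt ℝ 2 g z :=
    ((hg z hz).contDiffAt (hU.mem_nhds hz)).of_le (WithTop.coe_le_coe.2 le_top)
  -- `Dg(z) I = J₀ (Dg(z) 1)`
  have hI : fderiv ℝ g z I = stdComplexStructure (fderiv ℝ g z 1) := by
    simpa using hhol z hz 1
  rw [InnerProductSpace.laplacian_eq_iteratedFDeriv_complexPlane]
  beta_reduce
  rw [hessian_comp hψ hg2 1, hessian_comp hψ hg2 I, sndFDeriv_I_I hU hz hg hhol, hI, map_neg]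
  ring

end Summit.SmoothPoincare4.SmoothPoincare4.Theorems.HyperbolicEnd.Negative

end
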